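import Mathlib

set_option linter.dupNamespace false

/-!
# Cluster law, part A (lens 4, g28): tables `ZMod p → ZMod 2` annihilated by mixed differences are constant (`p` odd)

Algebra side of the run dichotomy `(c0)_s` for SEVERAL uncertified quadratic registers (S-PRIME §12).  After the pencil of the `s`
quadratic forms is reduced to a jointly free basis, perfectness of the XOR strategy on a class says that the register tables
`G_j : 𝔽_p → 𝔽_2` satisfy a FUNCTIONAL EQUATION `Σ_j G_j(φ_j(q) + c_j) ≡ h` on `𝔽_p^r`; differencing along directions in the kernels
of the other functionals shows that every cluster sum is annihilated by a product of difference operators in non-zero directions.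
This file proves the number-theoretic heart — such a table is CONSTANT, because `p` is odd and the values live in characteristic two
(a «polynomial map» between groups of coprime orders is constant):
* `const_of_fdiff_eq_zero` — zero difference in a non-zero direction ⇒ constant;
* `not_fdiff_eq_one` — no table has difference identically `1` (wrap-around `x + p•d = x`);
* `const_of_iterFdiff_eq_zero` — MIXED DIFFERENCES: `Δ_{d₁} ⋯ Δ_{d_k} G ≡ 0` with all `d_i ≠ 0` ⇒ `G` constant;
* `cauchy_three` — the worked instance with three registers reading `x`, `y`, `x + y` (the first configuration of `(c0)₃` beyond
  `(c0)₂`): `G₁ x + G₂ y + G₃ (x + y) ≡ h` forces all three tables to be constant.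
-/

namespace Summit.QuantumAdvantage.QuantumAdvantage.Theorems.ClusterLaw

variable {p : ℕ} [Fact p.Prime]

/-- forward difference of a table in direction `d` -/
def fdiff (d : ZMod p) (G : ZMod p → ZMod 2) : ZMod p → ZMod 2 := fun x => G (x + d) - G x

/-- unfolding lemma -/
theorem fdiff_apply (d : ZMod p) (G : ZMod p → ZMod 2) (x : ZMod p) : fdiff d G x = G (x + d) - G x := rfl

/-- a table whose difference in direction `d` is a constant `κ` is an arithmetic progression along `d` -/
theorem apply_nat_mul_of_fdiff_const (d : ZMod p) (G : ZMod p → ZMod 2) (κ : ZMod 2) (h : ∀ x, fdiff d G x = κ) (x : ZMod p) :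
    ∀ k : ℕ, G (x + k * d) = G x + k * κ := by
  intro k
  induction k with
  | zero => simp
  | succ k ih =>
    have hk := h (x + k * d)
    rw [fdiff_apply] at hk
    have : x + ((k + 1 : ℕ) : ZMod p) * d = x + k * d + d := by push_cast; ring
    rw [this, Nat.cast_succ, add_mul, one_mul, ← add_assoc, ← ih]
    have := sub_eq_iff_eq_add.mp hk
    rw [this, add_comm]

/-- zero difference in a NON-ZERO direction ⇒ constant (`d` generates `ZMod p`) -/
theorem const_of_fdiff_eq_zero (d : ZMod p) (hd : d ≠ 0) (G : ZMod p → ZMod 2) (h : ∀ x, fdiff d G x = 0) (x : ZMod p) :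
    G x = G 0 := by
  have hx : x = 0 + ((x * d⁻¹).val : ℕ) * d := by
    rw [ZMod.natCast_zmod_val, zero_add, mul_assoc, inv_mul_cancel₀ hd, mul_one]
  have := apply_nat_mul_of_fdiff_const d G 0 h 0 (x * d⁻¹).val
  rw [← hx, mul_zero, add_zero] at this
  exact this

/-- no table has difference identically ONE in any direction: wrap-around `x + p•d = x` and `p` odd -/
theorem not_fdiff_eq_one (hp : p ≠ 2) (d : ZMod p) (G : ZMod p → ZMod 2) (h : ∀ x, fdiff d G x = 1) : False := by
  have := apply_nat_mul_of_fdiff_const d G 1 h 0 p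
  rw [ZMod.natCast_self, zero_mul, add_zero, mul_one] at this
  have h2 : ((p : ℕ) : ZMod 2) = 0 := by
    have := congrArg (fun z => z - G 0) this
    simpa using this.symm
  rw [ZMod.natCast_eq_zero_iff] at h2
  have := (Nat.Prime.eq_one_or_self_of_dvd (Fact.out : p.Prime) 2 h2)
  omega

/-- iterated mixed differences along a list of directions -/
def iterFdiff (ds : List (ZMod p)) (G : ZMod p → ZMod 2) : ZMod p → ZMod 2 := ds.foldr (fun d H => fdiff d H) G

/-- unfolding lemma: no directions -/
theorem iterFdiff_nil (G : ZMod p → ZMod 2) : iterFdiff [] G = G := rfl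

/-- unfolding lemma: one more direction -/
theorem iterFdiff_cons (d : ZMod p) (ds : List (ZMod p)) (G : ZMod p → ZMod 2) :
    iterFdiff (d :: ds) G = fdiff d (iterFdiff ds G) := rfl

/-- **MIXED DIFFERENCES.**  If `Δ_{d₁} ⋯ Δ_{d_k} G ≡ 0` with every `d_i ≠ 0`, then `G` is constant (`p` odd). -/
theorem const_of_iterFdiff_eq_zero (hp : p ≠ 2) :
    ∀ (ds : List (ZMod p)), (∀ d ∈ ds, d ≠ 0) → ∀ G : ZMod p → ZMod 2, (∀ x, iterFdiff ds G x = 0) → ∀ x, G x = G 0 := by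
  intro ds
  induction ds with
  | nil => intro _ G h x; rw [iterFdiff_nil] at h; rw [h x, h 0]
  | cons d ds ih =>
    intro hds G h x
    have hd : d ≠ 0 := hds d (by simp)
    have hds' : ∀ d' ∈ ds, d' ≠ 0 := fun d' hd' => hds d' (by simp [hd'])
    -- `H := Δ_{ds} G` has zero `d`-difference, hence is constant
    have hH : ∀ z, iterFdiff ds G z = iterFdiff ds G 0 := fun z => const_of_fdiff_eq_zero d hd _ (fun z => by
      have := h z; rwa [iterFdiff_cons] at this) z
    -- the constant is `0` or `1`
    rcases ds with _ | ⟨d', ds'⟩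
    · -- no further differences: `G` itself is constant
      rw [iterFdiff_nil] at hH; exact hH x
    · have h01 : iterFdiff (d' :: ds') G 0 = 0 ∨ iterFdiff (d' :: ds') G 0 = 1 := by
        generalize iterFdiff (d' :: ds') G 0 = z
        fin_cases z
        · exact Or.inl rfl
        · exact Or.inr rfl
      rcases h01 with h0 | h1
      · exact ih hds' G (fun z => by rw [hH z, h0]) x
      · exfalso
        refine not_fdiff_eq_one hp d' (iterFdiff ds' G) fun z => ?_
        have := hH z; rw [h1, iterFdiff_cons] at this; exact this

/-- **CAUCHY INSTANCE of `(c0)₃`.**  Three registers reading the pencil values `x`, `y`, `x + y` with `G₁ x + G₂ y + G₃ (x + y) ≡ h`: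
all three tables are constant (so each register is certified individually). -/
theorem cauchy_three (hp : p ≠ 2) (G₁ G₂ G₃ : ZMod p → ZMod 2) (h : ZMod 2) (hFE : ∀ x y, G₁ x + G₂ y + G₃ (x + y) = h) :
    (∀ x, G₁ x = G₁ 0) ∧ (∀ y, G₂ y = G₂ 0) ∧ (∀ z, G₃ z = G₃ 0) := by
  -- `Δ_b Δ_a G₃ ≡ 0`: from the four instances `(x,y) = (z,a), (0,a), (z,0), (0,0)` hmm — use `(z, a)` and `(z + b, a)`, `(z, 0)`, `(z + b, 0)`
  have key : ∀ a z, G₃ (z + a) - G₃ z = G₃ a - G₃ 0 := by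
    intro a z
    have h1 := hFE z a
    have h2 := hFE z 0
    have h3 := hFE 0 a
    have h4 := hFE 0 0
    rw [add_zero] at h2; rw [zero_add] at h3; rw [add_zero] at h4
    -- eliminate: (h1 - h2) - (h3 - h4)
    have e1 : G₂ a - G₂ 0 + (G₃ (z + a) - G₃ z) = 0 := by rw [← sub_eq_zero_of_eq (h1.trans h2.symm)]; ring
    have e2 : G₂ a - G₂ 0 + (G₃ a - G₃ 0) = 0 := by rw [← sub_eq_zero_of_eq (h3.trans h4.symm)]; ring
    have := congrArg₂ (· - ·) e1 e2
    simp only [sub_self] at this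
    rw [← sub_eq_zero]; rw [← this]; ring
  have hG3 : ∀ z, G₃ z = G₃ 0 := by
    refine const_of_iterFdiff_eq_zero hp [1, 1] (by simp) G₃ fun z => ?_
    show fdiff 1 (fdiff 1 G₃) z = 0
    rw [fdiff_apply, fdiff_apply, fdiff_apply, key 1 (z + 1), key 1 z, sub_self]
  refine ⟨fun x => ?_, fun y => ?_, hG3⟩
  · have h1 := hFE x 0
    have h2 := hFE 0 0
    rw [add_zero, hG3 x] at h1; rw [add_zero] at h2
    have := h1.trans h2.symm
    -- G₁ x + G₂ 0 + G₃ 0 = G₁ 0 + G₂ 0 + G₃ 0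
    have := congrArg (fun w => w - G₂ 0 - G₃ 0) this
    simpa using this
  · have h1 := hFE 0 y
    have h2 := hFE 0 0
    rw [zero_add, hG3 y] at h1; rw [add_zero] at h2
    have := h1.trans h2.symm
    have := congrArg (fun w => w - G₁ 0 - G₃ 0) this
    simpa using this

end Summit.QuantumAdvantage.QuantumAdvantage.Theorems.ClusterLaw
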